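import Literature.Geometry.Manifold.ShuffleProductIntegral
import Literature.Geometry.Manifold.DeRhamComparison
import Literature.AlgebraicTopology.SingularHomology.CocycleLift
import Literature.AlgebraicTopology.SingularHomology.CupProduct
import Literature.AlgebraicTopology.SingularHomology.RelativeCapProduct
import HarnessLib

/-!
# The de Rham comparison isomorphism is multiplicative: wedge ↦ cup

Topic `Literature/Geometry/Manifold`. For a `C^∞` manifold `M` (Hausdorff, second countable,
finite-dimensional boundaryless model) the de Rham comparison isomorphism of the tree
(`…DeRhamComparison.deRhamComparisonIso ∘ deRhamIsoLocal`, `[α] ↦ [σ ↦ ∫_σ α]` followed by the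
inverse of the restriction to smooth chains) carries the cup product induced by the wedge
product (`deRhamCohomology.cup`) to the Alexander–Whitney cup product on singular cohomology
(`cupProduct`): **`[α ∧ β] ↦ [α] ⌣ [β]`** (`deRhamComparisonIso_cup`; de Rham 1931, Weil 1952;
Bredon (1993), Thm. V.9.5 with §VI.4; Warner (1983), Thm. 5.45; Bott–Tu (1982), Thm. 14.28).

Proof ("test on smooth cycles", Bredon VI §4):

1. *Lift.* Restriction of singular cochains to smooth chains, `ρ = toSmoothAll ∘ singIso`, is
   surjective in each degree (functionals extend from the smooth subspace) and a
   quasi-isomorphism (`isIso_homologyMap_toSmoothAll`), so every closed smooth form `α` has a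
   singular cocycle `φ_α` whose restriction to smooth chains is EXACTLY the integration cochain
   `c ↦ ∫_c α` (`…CocycleLift.exists_cocycle_lift`); then `φ_α(τ) = ∫_τ α` for every smooth
   simplex `τ` and the comparison class of `[α]` is `[φ_α]` (`exists_cocycle_res_eq`,
   `deRhamComparisonIso_apply_eq_homologyCls`).
2. *Reduce to cycles.* Two smooth cocycles with the same values on all smooth cycles have the
   same class (`…CocycleLift.dual_homologyCls_eq_of_forall_cycle`), so it suffices to check
   `∫_z α ∧ β = Σ_σ z_σ φ_α(σ|front) φ_β(σ|back)` for smooth cycles `z`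
   (`(φ_α ⌣ φ_β)(σ) = φ_α(σ|front) φ_β(σ|back)`, `cochainCup_apply`).
3. *The cycle identity* (`integrationFunctional_wedge_eq_sum`): `α ∧ β = Δ^*(α ⊠ β)`
   (`α ⊠ β = pr₁^*α ∧ pr₂^*β`, `…ShuffleProductIntegral.crossForm`), so
   `∫_z α ∧ β = ∫_{Δ_* z} α ⊠ β`; the Eilenberg–Zilber/Alexander–Whitney homotopy
   (`…EilenbergZilberChains`: `Δ_* z - AW z = ∂ H z` for a cycle `z`) and Stokes on the smooth
   chain `H z` (`integrationFunctional_localD`; `α ⊠ β` is closed) give `∫_{Δ_* z} = ∫_{AW z}`;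
   `AW σ = Σ_{p+q=n} (σ|front_p) × (σ|back_q)` (shuffle products) and the analytic core
   `∫_{σ' × τ'} α ⊠ β = (∫_{σ'} α)(∫_{τ'} β)` for matched degrees, `0` otherwise
   (`…ShuffleProductIntegral.integrationFunctional_crossForm_ezMap(_eq_zero)`) finish.

Everything is proved; no named facts. The multiplicativity of the tree's
`integrationDeRhamIsoFamily` and the discharge of `exists_deRhamIsoFamily` follow in
`Literature/NumberTheory/Transcendental/DeRhamTheoremMultiplicative.lean`.

## References

* G. E. Bredon, *Topology and Geometry*, GTM 139 (1993), Thm. V.9.5, §VI.4. [Bredon1993]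
* F. W. Warner, *Foundations of Differentiable Manifolds and Lie Groups* (1983), Thm. 5.45. [WarnerGTM94]
* R. Bott, L. W. Tu, *Differential Forms in Algebraic Topology* (1982), Thm. 14.28. [BottTu1982Forms]
-/

noncomputable section

-- see "Implementation notes" in `…SingularHomology.SingularChainsConcrete`
set_option backward.isDefEq.respectTransparency false

open scoped Manifold ContDiff Topology
open CategoryTheory Set Function Literature.AlgebraicTopology.SingularHomology
  Literature.AlgebraicTopology.SingularHomology.EilenbergZilber Literature.Geometry.Kaehler
  Literature.NumberTheory.Transcendental

universe u

namespace Literature.Geometry.Manifold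

variable {E : Type u} [NormedAddCommGroup E] [NormedSpace ℝ E]
  {H : Type u} [TopologicalSpace H] {I : ModelWithCorners ℝ E H}
  {M : Type u} [TopologicalSpace M] [ChartedSpace H M]

/-! ### Restriction of singular cochains to smooth chains -/

section Res

variable (I M) in
/-- **Restriction of singular cochains to smooth chains**: `C•(M; ℝ) ≅ Hom(Δ(M), ℝ) ⟶ Hom(Δ^{sm}(M), ℝ)`. [cite: Bredon1993, §V.9] -/
abbrev resSmooth : singularCochainComplex ℝ ℝ M ⟶ smoothSubsetCochains I ℝ realCoeff.{u} M univ :=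
  (singIso M).hom ≫ toSmoothAll I M

/-- The concrete chain underlying an element of the complex of smooth chains. [folklore] -/
abbrev chainOf {n : ℕ} (c : (smoothChainsInSub I ℝ ℝ M univ).toComplex.X n) : CChain ℝ M n := c.1

/-- **Values of a restricted singular cochain on a smooth chain**: `ρ(φ)(c) = Σ_σ c_σ φ(σ)`. [folklore] -/
theorem resSmooth_cochainVal {n : ℕ} (φ : (singularCochainComplex ℝ ℝ M).X n)
    (c : (smoothChainsInSub I ℝ ℝ M univ).toComplex.X n) :
    cochainVal ((resSmooth I M).f n φ) c = ∑ σ ∈ (chainOf c).support, chainOf c σ * φ σ := by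
  change (ULift.moduleEquiv (R := ℝ)) ((ModuleCat.Hom.hom ((singIso M).hom.f n φ)) (chainOf c)) = _
  have h : (ModuleCat.Hom.hom ((singIso M).hom.f n φ)) (chainOf c) =
      ∑ σ ∈ (chainOf c).support, ULift.up (chainOf c σ * φ σ) := by
    conv_lhs => rw [← Finsupp.sum_single (chainOf c)]
    rw [Finsupp.sum, map_sum]
    exact Finset.sum_congr rfl fun σ _ ↦ singIso_hom_f_apply_single φ σ _
  rw [h, map_sum]
  rfl

/-- A restricted singular cochain that is the integration cochain of a form takes the value
`∫_τ α` on every smooth simplex `τ`. [folklore] -/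
theorem apply_eq_formIntegral_of_res_eq [IsManifold I ∞ M] {k : ℕ} {φ : (singularCochainComplex ℝ ℝ M).X k}
    {η : (localDeRhamComplex I ℝ (isOpen_univ : IsOpen (univ : Set M))).X k}
    (hres : (resSmooth I M).f k φ = (deRhamMap I (isOpen_univ : IsOpen (univ : Set M))).f k η)
    {τ : SingularSimplex M k} (hτ : τ.IsSmooth I) : φ τ = τ.formIntegral (η.1 : MForm I M ℝ k) := by
  set c : (smoothChainsInSub I ℝ ℝ M univ).toComplex.X k :=
    ⟨Finsupp.single τ 1, single_mem_smoothChainsInSub hτ (subset_univ _) 1⟩ with hc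
  have h1 : cochainVal ((resSmooth I M).f k φ) c = φ τ := by
    rw [resSmooth_cochainVal]
    change ∑ σ ∈ (Finsupp.single τ (1 : ℝ)).support, (Finsupp.single τ (1 : ℝ)) σ * φ σ = φ τ
    rw [Finsupp.support_single τ one_ne_zero, Finset.sum_singleton, Finsupp.single_eq_same, one_mul]
  have h2 : cochainVal ((deRhamMap I (isOpen_univ : IsOpen (univ : Set M))).f k η) c = τ.formIntegral (η.1 : MForm I M ℝ k) := by
    rw [deRhamMap_cochainVal]
    change integrationFunctional (η.1 : MForm I M ℝ k) (Finsupp.single τ 1) = _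
    rw [integrationFunctional_single, one_mul]
  rw [← h1, hres, h2]

/-- **Restriction to smooth chains is surjective in each degree** (linear functionals extend from
the subspace of smooth chains). [folklore] -/
theorem resSmooth_f_surjective (n : ℕ) : Function.Surjective ((resSmooth I M).f n) := by
  intro ψ
  -- extend the functional `ψ` on smooth chains to all chains
  obtain ⟨g, hg⟩ := LinearMap.exists_extend (ModuleCat.Hom.hom ψ :
    ↥(smoothChainsInSub I ℝ ℝ M univ n) →ₗ[ℝ] ULift.{u} ℝ)
  set ψ' : (dualObj ℝ realCoeff.{u} (csingularChainComplex ℝ ℝ M)).X n := ModuleCat.ofHom g with hψ'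
  -- `singIso` is an isomorphism, hence surjective in degree `n`
  obtain ⟨φ, hφ⟩ := ((ConcreteCategory.isIso_iff_bijective ((singIso M).hom.f n)).mp inferInstance).2 ψ'
  refine ⟨φ, ?_⟩
  change (toSmoothAll I M).f n ((singIso M).hom.f n φ) = ψ
  rw [hφ, toSmoothAll, dualMap_f_apply]
  refine ModuleCat.hom_ext ?_
  rw [ModuleCat.hom_comp, hψ', ModuleCat.hom_ofHom]
  exact hg

end Res

/-! ### The cocycle representing a closed form -/

section Lift

variable [IsManifold I ∞ M] [I.Boundaryless] [FiniteDimensional ℝ E] [T2Space M] [SecondCountableTopology M]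
  [LocallyCompactSpace M]

/-- Restriction to smooth chains induces a bijection on cohomology. [cite: Bredon1993, Thm. V.9.5] -/
theorem bijective_homologyMap_resSmooth (k : ℕ) :
    Function.Bijective (HomologicalComplex.homologyMap (resSmooth I M) k) := by
  haveI := isIso_homologyMap_toSmoothAll (I := I) (M := M) k
  haveI : IsIso (HomologicalComplex.homologyMap (singIso M).hom k) :=
    (HomologicalComplex.homologyFunctor _ _ k).map_isIso (singIso M).hom
  rw [HomologicalComplex.homologyMap_comp]
  exact (ConcreteCategory.isIso_iff_bijective _).mp inferInstance

/-- **Every closed smooth form has a singular cocycle whose restriction to smooth chains is exactly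
its integration cochain.** [cite: Bredon1993, Thm. V.9.5] -/
theorem exists_cocycle_res_eq (k : ℕ) (α : closedSmoothForms I M ℝ k) :
    ∃ φ : (singularCochainComplex ℝ ℝ M).X k, (singularCochainComplex ℝ ℝ M).d k (k + 1) φ = 0 ∧
      (resSmooth I M).f k φ = (deRhamMap I (isOpen_univ : IsOpen (univ : Set M))).f k (closedToUniv I M ℝ k α) := by
  obtain ⟨φ, hφ, hres⟩ := exists_cocycle_lift (resSmooth I M) resSmooth_f_surjective k
    (bijective_homologyMap_resSmooth k) _ (d_hom_f_eq_zero _ _ (d_closedToUniv α))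
  refine ⟨φ, ?_, hres⟩
  rwa [d_next_eq_zero_iff ((ComplexShape.up ℕ).next_eq' (rfl : k + 1 = k + 1))] at hφ

/-- **The comparison class of `[α]` is the class of any such cocycle.** [cite: Bredon1993, Thm. V.9.5] -/
theorem deRhamComparisonIso_apply_eq_homologyCls (k : ℕ) (α : closedSmoothForms I M ℝ k)
    {φ : (singularCochainComplex ℝ ℝ M).X k} (hφ : (singularCochainComplex ℝ ℝ M).d k ((ComplexShape.up ℕ).next k) φ = 0)
    (hres : (resSmooth I M).f k φ = (deRhamMap I (isOpen_univ : IsOpen (univ : Set M))).f k (closedToUniv I M ℝ k α)) :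
    (deRhamComparisonIso I M k).hom (deRhamIsoLocal I M ℝ k (deRhamCohomology.mk α)) = homologyCls φ hφ := by
  apply (bijective_homologyMap_resSmooth (I := I) (M := M) k).1
  have hcomp := deRhamComparisonIso_hom_comp (I := I) (M := M) k
  have h1 : HomologicalComplex.homologyMap (resSmooth I M) k
      ((deRhamComparisonIso I M k).hom (deRhamIsoLocal I M ℝ k (deRhamCohomology.mk α))) =
      HomologicalComplex.homologyMap (deRhamMap I (isOpen_univ : IsOpen (univ : Set M))) k
        (deRhamIsoLocal I M ℝ k (deRhamCohomology.mk α)) := by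
    rw [← hcomp, HomologicalComplex.homologyMap_comp]
    rfl
  rw [h1, deRhamIsoLocal_mk, homologyMap_homologyCls, homologyMap_homologyCls]
  exact homologyCls_congr hres.symm _ _

end Lift

/-! ### The cup product of cocycle classes -/

section Cup

variable {X : Type u} [TopologicalSpace X] {p q n : ℕ}

/-- The cup product of the classes of two cocycles is the class of their Alexander–Whitney cup
product. [cite: HatcherAT2002, §3.2 p. 206] -/
theorem cupProduct_homologyCls (h : p + q = n) (φ : (singularCochainComplex ℝ ℝ X).X p) (ψ : (singularCochainComplex ℝ ℝ X).X q)
    (hφ : (singularCochainComplex ℝ ℝ X).d p ((ComplexShape.up ℕ).next p) φ = 0)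
    (hψ : (singularCochainComplex ℝ ℝ X).d q ((ComplexShape.up ℕ).next q) ψ = 0)
    (hcup : (singularCochainComplex ℝ ℝ X).d n ((ComplexShape.up ℕ).next n) (cochainCup h φ ψ) = 0) :
    cupProduct h (homologyCls φ hφ) (homologyCls ψ hψ) = homologyCls (cochainCup h φ ψ) hcup := by
  have hφ' : (singularCochainComplex ℝ ℝ X).d p (p + 1) φ = 0 := by
    rwa [d_next_eq_zero_iff ((ComplexShape.up ℕ).next_eq' (rfl : p + 1 = p + 1))] at hφ
  have hψ' : (singularCochainComplex ℝ ℝ X).d q (q + 1) ψ = 0 := by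
    rwa [d_next_eq_zero_iff ((ComplexShape.up ℕ).next_eq' (rfl : q + 1 = q + 1))] at hψ
  have hcup' : (singularCochainComplex ℝ ℝ X).d n (n + 1) (cochainCup h φ ψ) = 0 := by
    rwa [d_next_eq_zero_iff ((ComplexShape.up ℕ).next_eq' (rfl : n + 1 = n + 1))] at hcup
  rw [homologyCls_eq_homologyπ_cyclesMk φ hφ (p + 1) ((ComplexShape.up ℕ).next_eq' (rfl : p + 1 = p + 1)) hφ',
    homologyCls_eq_homologyπ_cyclesMk ψ hψ (q + 1) ((ComplexShape.up ℕ).next_eq' (rfl : q + 1 = q + 1)) hψ',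
    homologyCls_eq_homologyπ_cyclesMk _ hcup (n + 1) ((ComplexShape.up ℕ).next_eq' (rfl : n + 1 = n + 1)) hcup']
  change cupProduct h (singularCohomology.π ℝ ℝ X p (singularCochainComplex.cocyclesMk φ hφ'))
      (singularCohomology.π ℝ ℝ X q (singularCochainComplex.cocyclesMk ψ hψ')) =
    singularCohomology.π ℝ ℝ X n (singularCochainComplex.cocyclesMk (cochainCup h φ ψ) hcup')
  rw [cupProduct_π_π]
  congr 1
  apply (ModuleCat.mono_iff_injective (singularCochainComplex.iCocycles ℝ ℝ X n)).mp inferInstance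
  rw [singularCochainComplex.iCocycles_cocyclesCup, singularCochainComplex.iCocycles_mk, singularCochainComplex.iCocycles_mk,
    singularCochainComplex.iCocycles_mk]

end Cup

/-! ### The cycle identity -/

section Cycle

variable [IsManifold I ∞ M] {k l : ℕ}

omit [IsManifold I ∞ M] in
/-- The diagonal of `M`. [folklore] -/
theorem contMDiff_diag : ContMDiff I (I.prod I) ∞ fun x : M ↦ (x, x) := contMDiff_id.prodMk contMDiff_id

omit [IsManifold I ∞ M] in
/-- **`α ∧ β = Δ^*(α ⊠ β)`.** [cite: BottTu1982Forms, §I.1] -/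
theorem wedge_eq_pullback_crossForm (α : MForm I M ℝ k) (β : MForm I M ℝ l) :
    α.wedge β = (crossForm I I α β).pullback I fun x : M ↦ (x, x) := by
  rw [crossForm, MForm.pullback_wedge,
    ← MForm.pullback_comp ((contMDiff_fst (n := ∞)).mdifferentiable (by simp)) ((contMDiff_diag (I := I) (M := M)).mdifferentiable (by simp)),
    ← MForm.pullback_comp ((contMDiff_snd (n := ∞)).mdifferentiable (by simp)) ((contMDiff_diag (I := I) (M := M)).mdifferentiable (by simp))]
  change α.wedge β = (α.pullback I id).wedge (β.pullback I id)
  rw [MForm.pullback_id, MForm.pullback_id]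

/-- The cross product of closed smooth forms is a closed smooth form. [cite: BottTu1982Forms, §I.1] -/
theorem crossForm_mem_closedSmoothForms {α : MForm I M ℝ k} {β : MForm I M ℝ l} (hα : α ∈ closedSmoothForms I M ℝ k)
    (hβ : β ∈ closedSmoothForms I M ℝ l) : crossForm I I α β ∈ closedSmoothForms (I.prod I) (M × M) ℝ (k + l) := by
  haveI : WedgeFacts (I.prod I) (M × M) ℝ :=
    wedgeFacts_of_assoc (I.prod I) (M × M) ℝ (ContinuousAlternatingMap.WedgeAssoc_holds ℝ (E × E) ℝ)
  exact wedge_mem_closedSmoothForms (pullback_mem_closedSmoothForms contMDiff_fst hα)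
    (pullback_mem_closedSmoothForms contMDiff_snd hβ)

/-- The integration functional of the zero form vanishes. [folklore] -/
theorem integrationFunctional_zero_form {N : Type u} [TopologicalSpace N] [ChartedSpace H N] {n : ℕ} (c : CChain ℝ N n) :
    integrationFunctional (0 : MForm I N ℝ n) c = 0 := by
  rw [integrationFunctional_apply]
  exact Finset.sum_eq_zero fun σ _ ↦ by rw [SingularSimplex.formIntegral_zero, mul_zero]

/-- **Stokes kills boundaries for closed forms**: `∫_{∂c} ω = 0` for a closed smooth form `ω` and a
smooth chain `c`. [cite: LeeSmoothManifolds2013, Thm. 18.12] -/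
theorem integrationFunctional_bd_eq_zero_of_closed {N : Type u} [TopologicalSpace N] [ChartedSpace H N]
    {J : ModelWithCorners ℝ E H} [IsManifold J ∞ N] {n : ℕ} {η : MForm J N ℝ n} (hη : η ∈ closedSmoothForms J N ℝ n)
    {c : CChain ℝ N (n + 1)} (hc : c ∈ smoothChains J ℝ ℝ N (n + 1)) :
    integrationFunctional η (csingularChainComplex.bd ℝ n c) = 0 := by
  have hηU : η ∈ smoothFormsOn J ℝ (univ : Set N) n := by
    rw [smoothFormsOn_univ, mem_smoothForms_iff]; exact hη.1
  have hcU : c ∈ smoothChainsInSub J ℝ ℝ N univ (n + 1) :=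
    ⟨hc, (mem_chainsIn_iff ℝ ℝ c).2 fun σ _ ↦ subset_univ _⟩
  have h := integrationFunctional_localD isOpen_univ ⟨η, hηU⟩ hcU
  rw [coe_localD, MForm.restr_univ] at h
  change integrationFunctional (mextDeriv η) c = _ at h
  rw [← h, show mextDeriv η = 0 from hη.2, integrationFunctional_zero_form]

omit [IsManifold I ∞ M] in
/-- **The Eilenberg–Zilber/Alexander–Whitney relation on cycles, in every degree**:
`Δ_* z - AW z = ∂(H z)` for a cycle `z`. [cite: HatcherAT2002, §3.B pp. 277–278] -/
theorem diagChain_sub_awChain_eq_bd {N : Type u} [TopologicalSpace N] :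
    ∀ (n : ℕ) (z : CChain ℝ N n), (csingularChainComplex ℝ ℝ N).d n ((ComplexShape.down ℕ).next n) z = 0 →
      diagChain ℝ ℝ N n z - awChain ℝ ℝ N n z = csingularChainComplex.bd ℝ n (ezHChain ℝ ℝ N n z)
  | 0, z, _ => by rw [awChain_zero, ezHChain_zero, map_zero, sub_self]
  | n + 1, z, hz => by
    rw [d_next_eq_zero_iff ((ComplexShape.down ℕ).next_eq' (rfl : n + 1 = n + 1)), csingularChainComplex.d_apply] at hz
    exact diagChain_sub_awChain_of_bd_eq_zero hz

/-- Coefficients come out of shuffle products: `σ × τ` with coefficient `r` is `r • (σ × τ)`. [folklore] -/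
theorem ezMap_coeff {N : Type u} [TopologicalSpace N] {p q n : ℕ} (σ : SingularSimplex M p) (τ : SingularSimplex N q) (r : ℝ) :
    ezMap ℝ ℝ n σ τ r = r • ezMap ℝ ℝ n σ τ 1 := by
  have h : (r : ℝ) = r • (1 : ℝ) := by rw [smul_eq_mul, mul_one]
  conv_lhs => rw [h]
  rw [ezMap, ezMap, (realize₂ ℝ ℝ σ τ n (ShuffleChains.shuffle n p)).map_smul]

omit [IsManifold I ∞ M] in
/-- Front faces of smooth simplices are smooth (also available, with the same proof idea, as
`…SingularSimplex.IsSmooth.frontFace` in `DeRhamProductDefect.lean`; restated here to keep the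
import closure small). [folklore] -/
theorem frontFace_isSmooth {n p : ℕ} {σ : SingularSimplex M n} (hσ : σ.IsSmooth I) (h : p ≤ n) :
    (σ.frontFace h).IsSmooth I := by
  rw [SingularSimplex.frontFace_eq_compose]; exact hσ.compose _

omit [IsManifold I ∞ M] in
/-- Back faces of smooth simplices are smooth (cf. `…SingularSimplex.IsSmooth.backFace`). [folklore] -/
theorem backFace_isSmooth {n q : ℕ} {σ : SingularSimplex M n} (hσ : σ.IsSmooth I) (h : q ≤ n) :
    (σ.backFace h).IsSmooth I := by
  rw [SingularSimplex.backFace_eq_compose]; exact hσ.compose _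

/-- **The integral of a cross product over `AW σ`** for a smooth simplex `σ`: only the shuffle
product of matched degrees contributes, `∫_{AW σ} α ⊠ β = (∫_{σ|front_k} α)(∫_{σ|back_l} β)`. [cite: Bredon1993, §VI.4] -/
theorem integrationFunctional_crossForm_awMap {α : MForm I M ℝ k} {β : MForm I M ℝ l} (hα : IsSmoothForm α) (hβ : IsSmoothForm β)
    {σ : SingularSimplex M (k + l)} (hσ : σ.IsSmooth I) (r : ℝ) :
    integrationFunctional (crossForm I I α β) (awMap ℝ ℝ σ r) =
      r * ((σ.frontFace (Nat.le_add_right k l)).formIntegral α * (σ.backFace (Nat.le_add_left l k)).formIntegral β) := by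
  rw [awMap_eq_sum, map_sum, Finset.sum_eq_single (k, l)]
  · rw [dif_pos rfl, ezMap_coeff, map_smul, smul_eq_mul,
      integrationFunctional_crossForm_ezMap (frontFace_isSmooth hσ _) (backFace_isSmooth hσ _) hα hβ]
  · rintro ⟨p, q⟩ hx hne
    have hpq : p + q = k + l := Finset.mem_antidiagonal.mp hx
    rw [dif_pos hpq, ezMap_coeff, map_smul, smul_eq_mul]
    have hp : p ≠ k := fun hp ↦ hne (by subst hp; exact Prod.ext rfl (by simp only; omega))
    rw [integrationFunctional_crossForm_ezMap_eq_zero (frontFace_isSmooth hσ _) (backFace_isSmooth hσ _) hpq hp hα hβ, mul_zero]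
  · intro h; exfalso; exact h (Finset.mem_antidiagonal.mpr rfl)

/-- **The cycle identity**: for closed smooth forms `α ∈ Ωᵏ(M)`, `β ∈ Ωˡ(M)` and a smooth
`(k+l)`-cycle `z`,
`∫_z α ∧ β = Σ_σ z_σ (∫_{σ|[v₀…v_k]} α)(∫_{σ|[v_k…v_{k+l}]} β)`. [cite: Bredon1993, §VI.4] -/
theorem integrationFunctional_wedge_eq_sum {α : MForm I M ℝ k} {β : MForm I M ℝ l} (hα : α ∈ closedSmoothForms I M ℝ k)
    (hβ : β ∈ closedSmoothForms I M ℝ l) {z : CChain ℝ M (k + l)} (hzs : z ∈ smoothChains I ℝ ℝ M (k + l))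
    (hz : (csingularChainComplex ℝ ℝ M).d (k + l) ((ComplexShape.down ℕ).next (k + l)) z = 0) :
    integrationFunctional (α.wedge β) z =
      ∑ σ ∈ z.support, z σ * ((σ.frontFace (Nat.le_add_right k l)).formIntegral α *
        (σ.backFace (Nat.le_add_left l k)).formIntegral β) := by
  -- `∫_z α ∧ β = ∫_{Δ_* z} α ⊠ β`
  rw [wedge_eq_pullback_crossForm, ← integrationFunctional_mapDomain contMDiff_diag _ hzs,
    ← csingularChainComplex.map_f_apply (R := ℝ), ← diagChain_eq_map]
  -- `Δ_* z = AW z + ∂ (H z)` and Stokes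
  have hdec : diagChain ℝ ℝ M (k + l) z = awChain ℝ ℝ M (k + l) z + csingularChainComplex.bd ℝ (k + l) (ezHChain ℝ ℝ M (k + l) z) := by
    rw [← diagChain_sub_awChain_eq_bd (k + l) z hz, add_sub_cancel]
  rw [hdec, map_add, integrationFunctional_bd_eq_zero_of_closed (crossForm_mem_closedSmoothForms hα hβ)
    (ezHChain_mem_smoothChains hzs), add_zero]
  -- `AW z = Σ_σ AW(z_σ σ)`
  conv_lhs => rw [← Finsupp.sum_single z, Finsupp.sum, map_sum, map_sum]
  refine Finset.sum_congr rfl fun σ hσ ↦ ?_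
  rw [awChain_single, integrationFunctional_crossForm_awMap hα.1 hβ.1 ((mem_smoothChains_iff z).1 hzs σ hσ)]

end Cycle

/-! ### Multiplicativity of the comparison isomorphism -/

section Main

variable [IsManifold I ∞ M] [I.Boundaryless] [FiniteDimensional ℝ E] [T2Space M] [SecondCountableTopology M]
  [LocallyCompactSpace M] [WedgeFacts I M ℝ]

/-- **The de Rham comparison isomorphism is multiplicative**: it sends `[α] ⌣ [β] = [α ∧ β]` to
the Alexander–Whitney cup product `[φ_α] ⌣ [φ_β]` (de Rham 1931; Bredon (1993), Thm. V.9.5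
with §VI.4; Warner (1983), Thm. 5.45; Bott–Tu (1982), Thm. 14.28). [cite: Bredon1993, §VI.4] -/
theorem deRhamComparisonIso_cup (k l : ℕ) (a : deRhamCohomology I M ℝ k) (b : deRhamCohomology I M ℝ l) :
    (deRhamComparisonIso I M (k + l)).hom (deRhamIsoLocal I M ℝ (k + l) (deRhamCohomology.cup rfl a b)) =
      cupProduct rfl ((deRhamComparisonIso I M k).hom (deRhamIsoLocal I M ℝ k a))
        ((deRhamComparisonIso I M l).hom (deRhamIsoLocal I M ℝ l b)) := by
  obtain ⟨α, rfl⟩ := deRhamCohomology.mk_surjective a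
  obtain ⟨β, rfl⟩ := deRhamCohomology.mk_surjective b
  obtain ⟨φ, hφ, hresφ⟩ := exists_cocycle_res_eq (I := I) (M := M) k α
  obtain ⟨ψ, hψ, hresψ⟩ := exists_cocycle_res_eq (I := I) (M := M) l β
  have hφn : (singularCochainComplex ℝ ℝ M).d k ((ComplexShape.up ℕ).next k) φ = 0 := by
    rwa [d_next_eq_zero_iff ((ComplexShape.up ℕ).next_eq' (rfl : k + 1 = k + 1))]
  have hψn : (singularCochainComplex ℝ ℝ M).d l ((ComplexShape.up ℕ).next l) ψ = 0 := by
    rwa [d_next_eq_zero_iff ((ComplexShape.up ℕ).next_eq' (rfl : l + 1 = l + 1))]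
  -- the cup of the two cocycles is a cocycle
  have hcup : (singularCochainComplex ℝ ℝ M).d (k + l) ((ComplexShape.up ℕ).next (k + l)) (cochainCup rfl φ ψ) = 0 := by
    have hφ' : (singularCochainComplex ℝ ℝ M).d k (k + 1) φ = 0 := hφ
    have hψ' : (singularCochainComplex ℝ ℝ M).d l (l + 1) ψ = 0 := hψ
    rw [d_next_eq_zero_iff ((ComplexShape.up ℕ).next_eq' (rfl : k + l + 1 = k + l + 1))]
    have h := singularCochainComplex.d_iCocycles_apply (R := ℝ) (M := ℝ) (X := M) (n := k + l) (k + l + 1)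
      (singularCochainComplex.cocyclesCup rfl (singularCochainComplex.cocyclesMk φ hφ') (singularCochainComplex.cocyclesMk ψ hψ'))
    rw [singularCochainComplex.iCocycles_cocyclesCup, singularCochainComplex.iCocycles_mk, singularCochainComplex.iCocycles_mk] at h
    exact singularCochainComplex.ext h
  rw [deRhamComparisonIso_apply_eq_homologyCls k α hφn hresφ, deRhamComparisonIso_apply_eq_homologyCls l β hψn hresψ,
    cupProduct_homologyCls rfl φ ψ hφn hψn hcup, deRhamCohomology.cup_mk_mk]
  -- apply the injective map `H(ρ)` and compute both sides as classes of smooth cochains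
  apply (bijective_homologyMap_resSmooth (I := I) (M := M) (k + l)).1
  have hcomp := deRhamComparisonIso_hom_comp (I := I) (M := M) (k + l)
  have h1 : HomologicalComplex.homologyMap (resSmooth I M) (k + l)
      ((deRhamComparisonIso I M (k + l)).hom (deRhamIsoLocal I M ℝ (k + l)
        (deRhamCohomology.mk (deRhamCohomology.closedWedge rfl α β)))) =
      HomologicalComplex.homologyMap (deRhamMap I (isOpen_univ : IsOpen (univ : Set M))) (k + l)
        (deRhamIsoLocal I M ℝ (k + l) (deRhamCohomology.mk (deRhamCohomology.closedWedge rfl α β))) := by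
    rw [← hcomp, HomologicalComplex.homologyMap_comp]
    rfl
  rw [h1, deRhamIsoLocal_mk, homologyMap_homologyCls, homologyMap_homologyCls]
  -- test on smooth cycles
  refine dual_homologyCls_eq_of_forall_cycle (K := (smoothChainsInSub I ℝ ℝ M univ).toComplex) (k + l) _ _ _ _
    fun z hz ↦ ULift.ext _ _ ?_
  change cochainVal ((deRhamMap I (isOpen_univ : IsOpen (univ : Set M))).f (k + l)
      (closedToUniv I M ℝ (k + l) (deRhamCohomology.closedWedge rfl α β))) z =
    cochainVal ((resSmooth I M).f (k + l) (cochainCup rfl φ ψ)) z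
  rw [deRhamMap_cochainVal, resSmooth_cochainVal]
  change integrationFunctional (((α : MForm I M ℝ k).wedge (β : MForm I M ℝ l)).castDeg rfl) z.1 = _
  have hz' : (csingularChainComplex ℝ ℝ M).d (k + l) ((ComplexShape.down ℕ).next (k + l)) z.1 = 0 :=
    congrArg Subtype.val hz
  rw [MForm.castDeg_rfl, integrationFunctional_wedge_eq_sum α.2 β.2 z.2.1 hz']
  refine Finset.sum_congr rfl fun σ hσ ↦ ?_
  have hs : σ.IsSmooth I := (mem_smoothChains_iff z.1).1 z.2.1 σ hσ
  rw [cochainCup_apply, apply_eq_formIntegral_of_res_eq hresφ (frontFace_isSmooth hs _),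
    apply_eq_formIntegral_of_res_eq hresψ (backFace_isSmooth hs _)]
  rfl

end Main

end Literature.Geometry.Manifold
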